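import Summits.KontsevichZagierPeriods.KontsevichZagierPeriods.Theses.LiouvilleUnfolding
import Literature.NumberTheory.Transcendental.KZLogCalculusProofs
import Literature.NumberTheory.Transcendental.SemialgebraicDerivativeProofs

/-!
# Sketch (crux-ideate, ideator 3): first lemmas of the two lines for crux `UnfoldedLogStokes`
(item stmt-KontsevichZagierPeriods-2835, route LiouvilleUnfolding).

* dictionary checks (`rfl`): the item's set-builder domains ARE `KZlog.band …`, the shape consumed by
  the tree theorem `KZ.unfoldedLogStokes_mem_relations`;
* Card A (`null-boundary-transport`): a.e.-congruence of KZ representations, the `H'' := r₁(·,1)`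
  trick, the Tonelli converse;
* Card B (`rep-level-rerun`): existential fibre substitution with transported integrability and the
  derivative-free `θ`-move written in `G := r₄.integrand`.
Statements only (sorried); they must elaborate.
-/

noncomputable section

open MeasureTheory Set
open Literature.NumberTheory.Transcendental
open Literature.ModelTheory.ExponentialFields (IsSemialgebraic)

namespace Summit.KontsevichZagierPeriods.KontsevichZagierPeriods.Cruxes.UnfoldedLogStokes.Sketch3

variable {n m : ℕ}

/-! ## The crux, by name -/

example : Prop := Summit.KontsevichZagierPeriods.KontsevichZagierPeriods.Theses.LiouvilleUnfolding.UnfoldedLogStokes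

/-! ## Dictionary checks: the item's set-builders are `KZlog.band` (definitionally) -/

example (τ : Set (Fin n → ℝ)) (a b : (Fin n → ℝ) → ℝ) :
    {z : Fin (n + 1) → ℝ | (Fin.init z : Fin n → ℝ) ∈ τ ∧ a (Fin.init z) ≤ z (Fin.last n) ∧
      z (Fin.last n) ≤ b (Fin.init z)} = KZlog.band τ a b := rfl

example (B : Set (Fin (n + 1) → ℝ)) (V : (Fin (n + 1) → ℝ) → ℝ) :
    {w : Fin (n + 2) → ℝ | (Fin.init w : Fin (n + 1) → ℝ) ∈ B ∧ 1 ≤ w (Fin.last (n + 1)) ∧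
      w (Fin.last (n + 1)) ≤ V (Fin.init w)} = KZlog.band B (fun _ => 1) V := rfl

example (τ : Set (Fin n → ℝ)) (b : (Fin n → ℝ) → ℝ) (V : (Fin (n + 1) → ℝ) → ℝ) :
    {z : Fin (n + 1) → ℝ | (Fin.init z : Fin n → ℝ) ∈ τ ∧ 1 ≤ z (Fin.last n) ∧
      z (Fin.last n) ≤ V (Fin.snoc (Fin.init z) (b (Fin.init z)))} =
      KZlog.band τ (fun _ => 1) fun x => V (Fin.snoc x (b x)) := rfl

/-- The open band (where the item pins the integrands of `r₄`, `r₁`) is the closed band minus the two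
edge graphs; used by both lines. -/
example (τ : Set (Fin n → ℝ)) (a b : (Fin n → ℝ) → ℝ) :
    {z : Fin (n + 1) → ℝ | (Fin.init z : Fin n → ℝ) ∈ τ ∧ a (Fin.init z) < z (Fin.last n) ∧
      z (Fin.last n) < b (Fin.init z)} ⊆ KZlog.band τ a b :=
  fun _ hz => ⟨hz.1, hz.2.1.le, hz.2.2.le⟩

/-! ## Card A — `null-boundary-transport`: first lemmas -/

/-- **A.1 (first lemma) a.e.-congruence.** Two KZ representations with the same domain whose
integrands agree off a Lebesgue-null `ℚ`-semialgebraic set differ by a relation (domain additivity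
along `N`, null-domain junk `KZ.of_mem_relations_of_volume_eq_zero`, congruence
`KZ.of_sub_of_mem_relations_of_eqOn`). -/
theorem of_sub_of_mem_relations_of_eqOn_off_null {r r' : KZ.IntegralRep n}
    (N : Set (Fin n → ℝ)) (hN : IsSemialgebraic ℚ N) (hN0 : volume N = 0)
    (hd : r'.domain = r.domain) (h : EqOn r.integrand r'.integrand (r.domain \ N)) :
    KZ.of r - KZ.of r' ∈ KZ.relations := by
  sorry

/-- **A.2 glue (a), the `H''` trick.** Since `V ≥ 1`, `(z, 1) ∈ r₁.domain` for every `z` in the band,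
so `H'' z := r₁.integrand (z, 1)` is `ℚ`-semialgebraic on the whole closed band (composition with the
polynomial map `z ↦ (z, 1)`, `IsSemialgebraicFunOn.comp_isSemialgebraicMapOn_holds`), and equals `H'`
on the open band by the item's pinning hypothesis. -/
theorem isSemialgebraicFunOn_integrand_snoc_one {B : Set (Fin (n + 1) → ℝ)}
    {V : (Fin (n + 1) → ℝ) → ℝ} (hB : IsSemialgebraic ℚ B) (hV1 : ∀ z ∈ B, 1 ≤ V z)
    (r₁ : KZ.IntegralRep (n + 2)) (hd : r₁.domain = KZlog.band B (fun _ => 1) V) :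
    IsSemialgebraicFunOn ℚ B fun z => r₁.integrand (Fin.snoc z 1) := by
  sorry

/-- **A.3 glue (a), `V''`.** The open-band `t`-derivative of `V`, extended by `0` to the edge graphs,
is `ℚ`-semialgebraic on the closed band (`IsSemialgebraicFunOn.hasDerivAt_last_isSemialgebraic_holds`
+ union of graphs) and is still the fibre derivative on open fibres. -/
theorem exists_semialgebraic_fibreDeriv {τ : Set (Fin n → ℝ)} {a b : (Fin n → ℝ) → ℝ}
    {V V' : (Fin (n + 1) → ℝ) → ℝ} (hτ : IsSemialgebraic ℚ τ)
    (ha : IsSemialgebraicFunOn ℚ τ a) (hb : IsSemialgebraicFunOn ℚ τ b)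
    (hV : IsSemialgebraicFunOn ℚ (KZlog.band τ a b) V)
    (hder : ∀ x ∈ τ, ∀ t ∈ Ioo (a x) (b x),
      HasDerivAt (fun s : ℝ => V (Fin.snoc x s)) (V' (Fin.snoc x t)) t) :
    ∃ V'' : (Fin (n + 1) → ℝ) → ℝ, IsSemialgebraicFunOn ℚ (KZlog.band τ a b) V'' ∧
      ∀ x ∈ τ, ∀ t ∈ Ioo (a x) (b x), V'' (Fin.snoc x t) = V' (Fin.snoc x t) := by
  sorry

/-- **A.4 glue (b), Tonelli converse** (exact fibre integral `∫⁻_{[1,v]} ‖f/s‖ = ‖f log v‖`,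
`KZlog.lintegral_enorm_div_Icc_one`, read backwards through `lintegral_prod`): integrability of the
unfolded monomial `[{1 ≤ s ≤ v}, f/s]` gives integrability of `f log v` on the base. Used three times
(`r₁ ↦ hintH'`, `r₂ ↦ hintb`, `r₃ ↦ hinta`). -/
theorem integrableOn_mul_log_of_integrableOn_band {σ : Set (Fin m → ℝ)} {f v : (Fin m → ℝ) → ℝ}
    (hσ : IsSemialgebraic ℚ σ) (hf : IsSemialgebraicFunOn ℚ σ f) (hv : IsSemialgebraicFunOn ℚ σ v)
    (hv1 : ∀ y ∈ σ, 1 ≤ v y) (R : KZ.IntegralRep (m + 1))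
    (hRd : R.domain = KZlog.band σ (fun _ => 1) v)
    (hRi : EqOn R.integrand (fun z => f (Fin.init z) / z (Fin.last m)) R.domain) :
    IntegrableOn (fun y => f y * Real.log (v y)) σ := by
  sorry

/-! ## Card B — `rep-level-rerun`: first lemmas -/

/-- **B.1 (first lemma) existential fibre substitution, integrability transported.** Same move as
`KZ.of_sub_of_mem_relations_fibreSubst`, but the box representation is PRODUCED: its integrability
comes through the affine substitution `s = 1 + θ (v − 1)` on the smooth locus of `v`
(`MeasureTheory.integrableOn_image_iff_integrableOn_abs_det_fderiv_smul`), zero on `int{v = 1}`,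
null remainder. No hypothesis on `f log v`. -/
theorem exists_fibreSubst {D : Set (Fin m → ℝ)} {f v : (Fin m → ℝ) → ℝ}
    (hD : IsSemialgebraic ℚ D) (hf : IsSemialgebraicFunOn ℚ D f) (hv : IsSemialgebraicFunOn ℚ D v)
    (hv1 : ∀ y ∈ D, 1 ≤ v y) (R₁ : KZ.IntegralRep (m + 1))
    (h₁d : R₁.domain = KZlog.band D (fun _ => 1) v)
    (h₁i : EqOn R₁.integrand (fun z => f (Fin.init z) / z (Fin.last m)) R₁.domain) :
    ∃ R₂ : KZ.IntegralRep (m + 1), R₂.domain = KZlog.band D (fun _ => 0) (fun _ => 1) ∧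
      EqOn R₂.integrand (fun z => f (Fin.init z) * (v (Fin.init z) - 1) /
        (1 + z (Fin.last m) * (v (Fin.init z) - 1))) R₂.domain ∧
      KZ.of R₁ - KZ.of R₂ ∈ KZ.relations := by
  sorry

/-- **B.2 derivative-free `θ`-move.** With `G := r₄.integrand` (`= H V'/V` on the open band) the box
representation `[B × [0,1], G V/S²]`, `S = 1 + θ (V − 1)`, is PRODUCED from `[B, G]` by ONE
Newton–Leibniz move along `θ` with the `ℚ`-semialgebraic primitive `G V θ/S`
(`∂_θ (θ/S) = 1/S²`, `[G V θ/S]₀¹ = G`); integrability by `KZ.integrableOn_box₂`. `V'` is never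
named, so no semialgebraicity of a derivative is needed. -/
theorem exists_boxTheta {B : Set (Fin (n + 1) → ℝ)} {G V : (Fin (n + 1) → ℝ) → ℝ}
    (hB : IsSemialgebraic ℚ B) (hG : IsSemialgebraicFunOn ℚ B G) (hV : IsSemialgebraicFunOn ℚ B V)
    (hV1 : ∀ z ∈ B, 1 ≤ V z) (RB : KZ.IntegralRep (n + 1)) (hRBd : RB.domain = B)
    (hRBi : EqOn RB.integrand G RB.domain) :
    ∃ Rg₂ : KZ.IntegralRep (n + 2), Rg₂.domain = KZlog.band B (fun _ => 0) (fun _ => 1) ∧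
      EqOn Rg₂.integrand (fun w => G (Fin.init w) * V (Fin.init w) /
        (1 + w (Fin.last (n + 1)) * (V (Fin.init w) - 1)) ^ 2) Rg₂.domain ∧
      KZ.of Rg₂ - KZ.of RB ∈ KZ.relations := by
  sorry

/-- **B.3 closing the fibres before the `t`-move.** A representation over the band with OPEN
`t`-fibres extends to one over the closed band (edge graphs are null and `ℚ`-semialgebraic), the two
differing by a relation; the Newton–Leibniz move along `t` only reads the integrand on open fibres. -/
theorem exists_closeFibres {σ : Set (Fin m → ℝ)} {a b : (Fin m → ℝ) → ℝ} {g : (Fin (m + 1) → ℝ) → ℝ}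
    (hσ : IsSemialgebraic ℚ σ) (ha : IsSemialgebraicFunOn ℚ σ a) (hb : IsSemialgebraicFunOn ℚ σ b)
    (hg : IsSemialgebraicFunOn ℚ (KZlog.band σ a b) g)
    (R : KZ.IntegralRep (m + 1))
    (hRd : R.domain = {z : Fin (m + 1) → ℝ | (Fin.init z : Fin m → ℝ) ∈ σ ∧
      a (Fin.init z) < z (Fin.last m) ∧ z (Fin.last m) < b (Fin.init z)})
    (hRi : EqOn R.integrand g R.domain) :
    ∃ R' : KZ.IntegralRep (m + 1), R'.domain = KZlog.band σ a b ∧ R'.integrand = g ∧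
      KZ.of R' - KZ.of R ∈ KZ.relations := by
  sorry

end Summit.KontsevichZagierPeriods.KontsevichZagierPeriods.Cruxes.UnfoldedLogStokes.Sketch3
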